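/-
Copyright (c) 2026. All rights reserved.
Released under Apache 2.0 license as described in the file LICENSE.
-/
import Literature.NumberTheory.Automorphic.EichlerOrderTwoSidedIdealsNormaliser
import HarnessLib

/-!
# The two-sided ideal theory for EVERY Eichler order of level `N⁺` in the definite quaternion algebra of discriminant `N⁻`:
# principal ⟺ norm element, (23.4.20), the normaliser, type invariance, and Voight's Prop. 18.5.10
# `#{[I'] ∈ Cls O : O_L(I') ≃ O'} · [N(O') : ℚ^×O'^×] = 2^{ω(N⁺N⁻)}`

[tag: quaternion_algebra] [tag: eichler_order] [tag: class_number]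

Topic `NumberTheory/Automorphic`; THEOREMS ONLY (no definition, no named fact, no instance, no notation; net debt `0`).
Lane `lit-hodgefound`, seat p12, gen 53 — the statements of `BrandtSetupTwoSidedIdealNorms.lean`,
`BrandtSetupTypeFibreCardinality.lean` and `EichlerOrderTwoSidedIdealsNormaliser.lean` (there for `O = S.O` and for the left
orders `O_L(I)`, `O_L(I_c)`) transported to an ARBITRARY Eichler order `O'` of level `N⁺` in `D`, through «every Eichler order of
level `N⁺` is a left order `O_L(I)` of some `I ∈ rightIdeals O`» (`XiSetup.exists_mem_rightIdeals_leftOrder_eq`, Voight Lemma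
17.4.6 with Prop. 23.4.3: the genus of an Eichler order is the set of Eichler orders of its level).

THE PRINTED STATEMENTS (J. Voight, *Quaternion Algebras*, GTM 288). **Lemma 18.5.1**, **Prop. 18.5.3**
(`N(O')/(F^×O'^×) ≅ PIdl(O')/PIdl(R)`), **(18.5.8)** (`#(Idl(O')/PIdl(O')) · #(N(O')/(F^×O'^×)) = #Pic_R(O')`), **Prop. 18.5.10**
(the fibre of `Cls O → Typ O` over the type of `O'` is `PIdl(O') \ Idl(O')`), **(23.4.20)** (`Idl(O')/Idl(R) ≅ ∏_{𝔭 ∣ 𝔑} ℤ/2ℤ`),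
for every order `O'` in the genus of `O`.

For a Brandt setup `S : XiSetup N⁺ N⁻` and an Eichler order `O'` of level `N⁺` in `S.D` (`Brandt.IsEichlerOrder S.D O' N⁺`):

* §1 **PRINCIPAL ⟺ NORM ELEMENT for `O'`**: `O' P_l(O') = x O'` for some `x ∈ D^×` iff `O' P_l(O')` contains an element of
  reduced norm `∏_{r ∈ l} localNorm r` (`XiSetup.exists_order_mul_twoSidedIdealProd_eq_units_smul_iff_of_isEichlerOrder`);
* §2 **(23.4.20) for `O'`** (two-sided ideals are `ℚ^× · O' P_l(O')`) and **Lemma 18.5.1 ∕ Prop. 18.5.3 for `O'`** (normaliser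
  elements ⟷ generators of principal `O' P_l(O')`, generator norm `∏ localNorm`);
* §3 **TYPE INVARIANCE AT THE LEVEL OF ORDERS**: Eichler orders `O' ≃ O''` of the same type have principal admissible products for
  the same `l` (`XiSetup.exists_norm_iff_of_sameType`);
* §4 **VOIGHT PROP. 18.5.10 WITH (18.5.8) FOR `O'`: `#{c ∈ Cls O : O_L(I_c) ≃ O'} · #{g ∈ (ℤ/2ℤ)^T : ∃ x ∈ O' P_{supp g}(O'),
  nrd x = ∏ localNorm} = 2^{#T}`** for `T ⊇ primes(N⁺N⁻)` (`XiSetup.natCard_sameType_mul_natCard_norm_eq_two_pow`):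
  the number of right-ideal classes of `O` with left order isomorphic to `O'` is `2^{ω(N⁺N⁻)} / [N(O') : ℚ^×O'^×]`; it divides
  `2^{ω(N⁺N⁻)}`, is positive, equals `2^{#T}` iff `O'` has no principal non-empty admissible product and `1` iff all are.

## References

* [Voight2021] J. Voight, *Quaternion Algebras*, GTM 288 (2021): Lemma 17.4.6, Lemma 17.4.13, Lemma 18.5.1, Prop. 18.5.3,
  (18.5.8), Prop. 18.5.10, Cor. 18.5.12, Prop. 23.4.3, (23.4.20).
* [VignerasLNM800] M.-F. Vignéras, *Arithmétique des algèbres de quaternions*, LNM 800 (1980), Ch. III §5 (Cor. 5.5 and the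
  remark following it; exercice 5.8).

## Scope (honest)

Theorems only; `[N(O') : ℚ^×O'^×]` enters as the count of principal admissible products, not as a group index.
-/

noncomputable section

open scoped Pointwise

universe u

namespace Literature.NumberTheory.Automorphic

open AtkinLehner

namespace Brandt

variable {Nplus Nminus : ℕ} (S : XiSetup Nplus Nminus)

/-! ## §1 Principal ⟺ norm element, for every Eichler order of level `N⁺` -/

/-- **PRINCIPAL ⟺ NORM ELEMENT for every Eichler order `O'` of level `N⁺` in `D`**: for a duplicate-free list `l` of primes,
`O' P_l(O') = x O'` for some `x ∈ D^×` iff `O' P_l(O')` contains an element of reduced norm `∏_{r ∈ l} localNorm r`.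
[cite: Voight2021, Lemma 18.5.1, Prop. 18.5.10 and Lemma 17.4.6] -/
theorem XiSetup.exists_order_mul_twoSidedIdealProd_eq_units_smul_iff_of_isEichlerOrder {O' : Submodule ℤ S.D}
    (hO' : Brandt.IsEichlerOrder S.D O' Nplus) {l : List ℕ} (hl : ∀ r ∈ l, r.Prime) (hnd : l.Nodup) :
    (∃ x : S.Dˣ, O' * S.twoSidedIdealProd O' l = x • O') ↔
      ∃ x ∈ O' * S.twoSidedIdealProd O' l, reducedNorm ℚ S.D x = ((l.map (localNorm Nplus Nminus)).prod : ℕ) := by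
  obtain ⟨I, hI, rfl⟩ := S.exists_mem_rightIdeals_leftOrder_eq S.nplus_ne_zero hO'
  exact S.exists_leftOrder_mul_twoSidedIdealProd_eq_units_smul_iff hI hl hnd

/-! ## §2 (23.4.20) and the normaliser, for every Eichler order of level `N⁺` -/

/-- **(23.4.20) for every Eichler order `O'` of level `N⁺`**: every two-sided `O'`-ideal `J` (`J ∈ rightIdeals O'`,
`O_L(J) = O'`) satisfies `m J = c · O' P_l(O')` for positive integers `m, c` and a duplicate-free list `l` of primes of `N⁺N⁻`.
[cite: Voight2021, (23.4.20) and Lemma 17.4.6] [cite: VignerasLNM800, Ch. III §5] -/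
theorem XiSetup.exists_smul_eq_smul_order_mul_twoSidedIdealProd_of_isEichlerOrder {O' : Submodule ℤ S.D}
    (hO' : Brandt.IsEichlerOrder S.D O' Nplus) {J : Submodule ℤ S.D} (hJ : J ∈ rightIdeals O') (hJL : leftOrder J = O') :
    ∃ m c : ℕ, m ≠ 0 ∧ c ≠ 0 ∧ ∃ l : List ℕ, l.Nodup ∧ (∀ r ∈ l, r.Prime ∧ r ∣ Nplus * Nminus) ∧
      (m : ℤ) • J = (c : ℤ) • (O' * S.twoSidedIdealProd O' l) := by
  obtain ⟨I, hI, rfl⟩ := S.exists_mem_rightIdeals_leftOrder_eq S.nplus_ne_zero hO'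
  exact S.exists_smul_eq_smul_leftOrder_mul_twoSidedIdealProd hI hJ hJL

/-- **Lemma 18.5.1 ∕ Prop. 18.5.3 for every Eichler order `O'` of level `N⁺`**: every `x ∈ N(O')` (`x O' x⁻¹ = O'`) has
`O' P_l(O') = (q x) O'` for an admissible duplicate-free `l` and a positive rational `q`. [cite: Voight2021, Lemma 18.5.1, Prop. 18.5.3 and Lemma 17.4.6] -/
theorem XiSetup.exists_order_mul_twoSidedIdealProd_eq_units_smul_of_conj_eq_of_isEichlerOrder {O' : Submodule ℤ S.D}
    (hO' : Brandt.IsEichlerOrder S.D O' Nplus) {x : S.Dˣ} (hx : x • (MulOpposite.op ((x⁻¹ : S.Dˣ) : S.D) • O') = O') :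
    ∃ l : List ℕ, l.Nodup ∧ (∀ r ∈ l, r.Prime ∧ r ∣ Nplus * Nminus) ∧ ∃ (q : ℚ) (y : S.Dˣ), 0 < q ∧
      (y : S.D) = algebraMap ℚ S.D q * x ∧ O' * S.twoSidedIdealProd O' l = y • O' := by
  obtain ⟨I, hI, rfl⟩ := S.exists_mem_rightIdeals_leftOrder_eq S.nplus_ne_zero hO'
  exact S.exists_leftOrder_mul_twoSidedIdealProd_eq_units_smul_of_conj_eq hI hx

/-- **Lemma 18.5.1 (⇐) for every Eichler order `O'` of level `N⁺`**: a generator `y` of `O' P_l(O') = y O'` normalises `O'` and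
has reduced norm `∏_{r ∈ l} localNorm r`. [cite: Voight2021, Lemma 18.5.1 and Lemma 17.4.6] -/
theorem XiSetup.units_conj_eq_and_reducedNorm_eq_of_isEichlerOrder {O' : Submodule ℤ S.D} (hO' : Brandt.IsEichlerOrder S.D O' Nplus)
    {l : List ℕ} (hl : ∀ r ∈ l, r.Prime) (hnd : l.Nodup) {y : S.Dˣ} (hy : O' * S.twoSidedIdealProd O' l = y • O') :
    y • (MulOpposite.op ((y⁻¹ : S.Dˣ) : S.D) • O') = O' ∧
      reducedNorm ℚ S.D (y : S.D) = ((l.map (localNorm Nplus Nminus)).prod : ℕ) := by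
  obtain ⟨I, hI, rfl⟩ := S.exists_mem_rightIdeals_leftOrder_eq S.nplus_ne_zero hO'
  exact S.units_conj_leftOrder_eq_and_reducedNorm_eq hI hl hnd hy

/-- **Reduced norms on the normaliser of every Eichler order `O'` of level `N⁺`: `nrd x = q² · ∏_{r ∈ l} localNorm r`.**
[cite: Voight2021, Lemma 18.5.1 and Prop. 18.5.3] [cite: VignerasLNM800, Ch. II §2] -/
theorem XiSetup.exists_reducedNorm_eq_sq_mul_of_conj_eq_of_isEichlerOrder {O' : Submodule ℤ S.D}
    (hO' : Brandt.IsEichlerOrder S.D O' Nplus) {x : S.Dˣ} (hx : x • (MulOpposite.op ((x⁻¹ : S.Dˣ) : S.D) • O') = O') :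
    ∃ l : List ℕ, l.Nodup ∧ (∀ r ∈ l, r.Prime ∧ r ∣ Nplus * Nminus) ∧ ∃ q : ℚ, 0 < q ∧
      reducedNorm ℚ S.D (x : S.D) = q ^ 2 * ((l.map (localNorm Nplus Nminus)).prod : ℕ) := by
  obtain ⟨I, hI, rfl⟩ := S.exists_mem_rightIdeals_leftOrder_eq S.nplus_ne_zero hO'
  exact (S.ofLeftOrder hI).exists_reducedNorm_eq_sq_mul_of_conj_eq hx

/-! ## §3 Type invariance at the level of orders -/

/-- **For right ideals `I, I'` of `O`: `O_L(I) P_l(O_L(I))` contains an element of reduced norm `∏ localNorm` iff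
`(W_{r_k} ∘ ⋯ ∘ W_{r_1}) [I] = [I]`** (`l = [r_1, …, r_k]` duplicate-free primes; the honest-representative form).
[cite: Voight2021, Prop. 18.5.10 and Lemma 18.5.1] -/
theorem XiSetup.exists_norm_leftOrder_iff_foldl_atkinLehner_mk_eq_self {I : Submodule ℤ S.D} (hI : I ∈ rightIdeals S.O)
    {l : List ℕ} (hl : ∀ r ∈ l, r.Prime) (hnd : l.Nodup) :
    (∃ x ∈ leftOrder I * S.twoSidedIdealProd (leftOrder I) l, reducedNorm ℚ S.D x = ((l.map (localNorm Nplus Nminus)).prod : ℕ)) ↔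
      l.foldl (fun c r => S.atkinLehner r c) (Quotient.mk (rightClassSetoid S.O) ⟨I, hI⟩) =
        Quotient.mk (rightClassSetoid S.O) ⟨I, hI⟩ := by
  rw [← S.exists_leftOrder_mul_twoSidedIdealProd_eq_units_smul_iff hI hl hnd]
  exact (S.foldl_atkinLehner_mk_eq_self_iff hl ⟨I, hI⟩).symm

/-- **TYPE INVARIANCE FOR ORDERS: Eichler orders `O', O''` of level `N⁺` of the same type (`O'' = β O' β⁻¹`) have principal
admissible products for the same `l`** — `O' P_l(O')` contains an element of reduced norm `∏ localNorm` iff `O'' P_l(O'')` does.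
[cite: Voight2021, Prop. 18.5.3, Prop. 18.5.10 and Lemma 17.4.13] -/
theorem XiSetup.exists_norm_iff_of_sameType {O' O'' : Submodule ℤ S.D} (hO' : Brandt.IsEichlerOrder S.D O' Nplus)
    (hO'' : Brandt.IsEichlerOrder S.D O'' Nplus) (h : SameType O' O'') {l : List ℕ} (hl : ∀ r ∈ l, r.Prime) (hnd : l.Nodup) :
    (∃ x ∈ O' * S.twoSidedIdealProd O' l, reducedNorm ℚ S.D x = ((l.map (localNorm Nplus Nminus)).prod : ℕ)) ↔
      ∃ x ∈ O'' * S.twoSidedIdealProd O'' l, reducedNorm ℚ S.D x = ((l.map (localNorm Nplus Nminus)).prod : ℕ) := by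
  obtain ⟨I, hI, rfl⟩ := S.exists_mem_rightIdeals_leftOrder_eq S.nplus_ne_zero hO'
  obtain ⟨I', hI', rfl⟩ := S.exists_mem_rightIdeals_leftOrder_eq S.nplus_ne_zero hO''
  rw [S.exists_norm_leftOrder_iff_foldl_atkinLehner_mk_eq_self hI hl hnd,
    S.exists_norm_leftOrder_iff_foldl_atkinLehner_mk_eq_self hI' hl hnd]
  exact S.foldl_atkinLehner_eq_self_iff_of_typeOf_eq ((typeOf_mk_eq_typeOf_mk_iff ⟨I, hI⟩ ⟨I', hI'⟩).mpr h) l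

/-- Hence the count `z(O') = #{g ∈ (ℤ/2ℤ)^T : ∃ x ∈ O' P_{supp g}(O'), nrd x = ∏ localNorm}` (`= [N(O') : ℚ^×O'^×]`) is an
invariant of the type of the Eichler order `O'`. [cite: Voight2021, Prop. 18.5.3 and Cor. 18.5.12] -/
theorem XiSetup.natCard_norm_eq_of_sameType (T : Finset ℕ) (hT : ∀ r ∈ T, r.Prime) {O' O'' : Submodule ℤ S.D}
    (hO' : Brandt.IsEichlerOrder S.D O' Nplus) (hO'' : Brandt.IsEichlerOrder S.D O'' Nplus) (h : SameType O' O'') :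
    Nat.card {g : T → Multiplicative (ZMod 2) //
        ∃ x ∈ O' * S.twoSidedIdealProd O' (suppSort T g),
          reducedNorm ℚ S.D x = (((suppSort T g).map (localNorm Nplus Nminus)).prod : ℕ)} =
      Nat.card {g : T → Multiplicative (ZMod 2) //
        ∃ x ∈ O'' * S.twoSidedIdealProd O'' (suppSort T g),
          reducedNorm ℚ S.D x = (((suppSort T g).map (localNorm Nplus Nminus)).prod : ℕ)} :=
  Nat.card_congr (Equiv.subtypeEquivRight fun g =>
    S.exists_norm_iff_of_sameType hO' hO'' h (fun _ hr => prime_of_mem_suppSort T hT g hr)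
      (nodup_suppSort T g))

/-! ## §4 Voight's Proposition 18.5.10 for every Eichler order of level `N⁺` -/

variable (T : Finset ℕ)

/-- The classes whose left order is of the type of `O_L(I)` are the fibre of the type map over `typeOf [I]`.
[cite: Voight2021, Lemma 17.4.13 and Prop. 18.5.10] -/
theorem XiSetup.sameType_leftOrder_rep_iff_typeOf_eq (I : rightIdeals S.O) (c : ClassSet S.O) :
    SameType (leftOrder c.rep) (leftOrder (I : Submodule ℤ S.D)) ↔
      typeOf S.O c = typeOf S.O (Quotient.mk (rightClassSetoid S.O) I) := by
  rw [typeOf_eq_typeOf_iff]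
  exact ⟨fun h => h.trans (sameType_leftOrder_rep_mk I), fun h => h.trans (sameType_leftOrder_rep_mk I).symm⟩

/-- **VOIGHT PROP. 18.5.10 WITH (18.5.8), FOR EVERY EICHLER ORDER `O'` OF LEVEL `N⁺`:
`#{c ∈ Cls O : O_L(I_c) ≃ O'} · #{g ∈ (ℤ/2ℤ)^T : ∃ x ∈ O' P_{supp g}(O'), nrd x = ∏_{supp g} localNorm} = 2^{#T}`** for every
finite set of primes `T ⊇ primes(N⁺N⁻)` — the number of right-ideal classes of `O` whose left order is isomorphic to `O'` is
`[Idl(O') : PIdl(O')] = 2^{ω(N⁺N⁻)} / [N(O') : ℚ^×O'^×]`. [cite: Voight2021, Prop. 18.5.10, (18.5.8), Prop. 18.5.3 and (23.4.20)] -/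
theorem XiSetup.natCard_sameType_mul_natCard_norm_eq_two_pow {O' : Submodule ℤ S.D}
    (hO' : Brandt.IsEichlerOrder S.D O' Nplus) (hT : (Nplus * Nminus).primeFactors ⊆ T) (hTp : ∀ r ∈ T, r.Prime) :
    Nat.card {c : ClassSet S.O // SameType (leftOrder c.rep) O'} *
        Nat.card {g : T → Multiplicative (ZMod 2) //
          ∃ x ∈ O' * S.twoSidedIdealProd O' (suppSort T g),
            reducedNorm ℚ S.D x = (((suppSort T g).map (localNorm Nplus Nminus)).prod : ℕ)} = 2 ^ T.card := by
  obtain ⟨I, hI, rfl⟩ := S.exists_mem_rightIdeals_leftOrder_eq S.nplus_ne_zero hO'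
  set c₀ : ClassSet S.O := Quotient.mk (rightClassSetoid S.O) ⟨I, hI⟩ with hc₀
  rw [← S.natCard_fibre_mul_natCard_norm_eq_two_pow T hT hTp c₀]
  congr 1
  · exact Nat.card_congr (Equiv.subtypeEquivRight fun c => S.sameType_leftOrder_rep_iff_typeOf_eq ⟨I, hI⟩ c)
  · exact S.natCard_norm_eq_of_sameType T hTp (S.isEichlerOrder_leftOrder hI)
      (S.isEichlerOrder_leftOrder_rep c₀) (sameType_leftOrder_rep_mk ⟨I, hI⟩)

/-- There is a class with left order of the type of `O'` (indeed equal to `O'`). [cite: Voight2021, Lemma 17.4.13 and Lemma 17.4.6] -/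
theorem XiSetup.natCard_sameType_pos {O' : Submodule ℤ S.D} (hO' : Brandt.IsEichlerOrder S.D O' Nplus) :
    0 < Nat.card {c : ClassSet S.O // SameType (leftOrder c.rep) O'} := by
  obtain ⟨I, hI, rfl⟩ := S.exists_mem_rightIdeals_leftOrder_eq S.nplus_ne_zero hO'
  exact Nat.card_pos_iff.mpr ⟨⟨⟨Quotient.mk (rightClassSetoid S.O) ⟨I, hI⟩, (sameType_leftOrder_rep_mk ⟨I, hI⟩).symm⟩⟩,
    inferInstance⟩

/-- **`#{c ∈ Cls O : O_L(I_c) ≃ O'} ∣ 2^{ω(N⁺N⁻)}`** for every Eichler order `O'` of level `N⁺`. [cite: Voight2021, Prop. 18.5.10 and (23.4.20)] -/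
theorem XiSetup.natCard_sameType_dvd_two_pow {O' : Submodule ℤ S.D} (hO' : Brandt.IsEichlerOrder S.D O' Nplus) :
    Nat.card {c : ClassSet S.O // SameType (leftOrder c.rep) O'} ∣ 2 ^ (Nplus * Nminus).primeFactors.card :=
  Dvd.intro _ (S.natCard_sameType_mul_natCard_norm_eq_two_pow _ hO' subset_rfl
    fun _ hr => Nat.prime_of_mem_primeFactors hr)

/-- `A · Z = M` with `A, Z > 0`: `A = M ↔ Z = 1` and `A = 1 ↔ Z = M`. [folklore] -/
private theorem eq_iff_of_mul_eq₆₀ {A Z M : ℕ} (h : A * Z = M) (hA : 0 < A) (hZ : 0 < Z) :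
    (A = M ↔ Z = 1) ∧ (A = 1 ↔ Z = M) := by
  subst h
  refine ⟨⟨fun hA' => Nat.eq_of_mul_eq_mul_left hA (by rw [mul_one]; exact hA'.symm), fun hZ1 => by rw [hZ1, mul_one]⟩,
    ⟨fun hA1 => by rw [hA1, one_mul], fun hZ' => Nat.eq_of_mul_eq_mul_right hZ (by rw [one_mul]; exact hZ'.symm)⟩⟩

/-- `#{g // P g} = 1 ↔` only `1` satisfies `P` (given `P 1`). [folklore] -/
private theorem natCard_subtype_eq_one_iff₆₀ {G : Type*} [One G] {P : G → Prop} (h1 : P 1) :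
    Nat.card {g // P g} = 1 ↔ ∀ g, P g → g = 1 := by
  rw [Nat.card_eq_one_iff_exists]
  constructor
  · rintro ⟨x, hx⟩ g hg
    exact congrArg Subtype.val ((hx ⟨g, hg⟩).trans (hx ⟨1, h1⟩).symm)
  · intro h
    exact ⟨⟨1, h1⟩, fun y => Subtype.ext (h y.1 y.2)⟩

/-- `#{g // P g} = #G ↔` every `g` satisfies `P` (`G` finite). [folklore] -/
private theorem natCard_subtype_eq_card_iff₆₀ {G : Type*} [Finite G] (P : G → Prop) :
    Nat.card {g // P g} = Nat.card G ↔ ∀ g, P g := by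
  constructor
  · intro h
    by_contra hne
    obtain ⟨g, hg⟩ := not_forall.mp hne
    exact absurd h (Finite.card_subtype_lt hg).ne
  · intro h
    exact Nat.card_congr (Equiv.subtypeUnivEquiv h)

/-- The empty product: `O' P_[](O') = O'` contains `1`, of reduced norm `1`. [cite: Voight2021, (23.4.20)] -/
theorem XiSetup.exists_norm_nil_of_isEichlerOrder {O' : Submodule ℤ S.D} (hO' : Brandt.IsEichlerOrder S.D O' Nplus) :
    ∃ x ∈ O' * S.twoSidedIdealProd O' [], reducedNorm ℚ S.D x = ((([] : List ℕ).map (localNorm Nplus Nminus)).prod : ℕ) :=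
  ⟨1, by rw [S.twoSidedIdealProd_nil, mul_one]; exact (isEichlerOrder_iff_brandt.mpr hO').isZOrder.one_mem,
    by rw [List.map_nil, List.prod_nil, Nat.cast_one, reducedNorm_one]⟩

/-- **`#{c : O_L(I_c) ≃ O'} = 2^{#T}` iff `O'` has NO principal non-empty admissible product** (`N(O') = ℚ^×O'^×`).
[cite: Voight2021, Prop. 18.5.10, (18.5.8) and Prop. 18.5.3] -/
theorem XiSetup.natCard_sameType_eq_two_pow_iff {O' : Submodule ℤ S.D} (hO' : Brandt.IsEichlerOrder S.D O' Nplus)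
    (hT : (Nplus * Nminus).primeFactors ⊆ T) (hTp : ∀ r ∈ T, r.Prime) :
    Nat.card {c : ClassSet S.O // SameType (leftOrder c.rep) O'} = 2 ^ T.card ↔
      ∀ g : T → Multiplicative (ZMod 2), g ≠ 1 →
        ¬ ∃ x ∈ O' * S.twoSidedIdealProd O' (suppSort T g),
            reducedNorm ℚ S.D x = (((suppSort T g).map (localNorm Nplus Nminus)).prod : ℕ) := by
  have key := S.natCard_sameType_mul_natCard_norm_eq_two_pow T hO' hT hTp
  have h1 : ∃ x ∈ O' * S.twoSidedIdealProd O' (suppSort T 1),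
      reducedNorm ℚ S.D x = (((suppSort T 1).map (localNorm Nplus Nminus)).prod : ℕ) := by
    have e : suppSort T (1 : T → Multiplicative (ZMod 2)) = [] :=
      List.eq_nil_iff_forall_not_mem.mpr fun r hr => by
        obtain ⟨h, hg⟩ := (mem_suppSort_iff T 1 r).mp hr
        exact hg rfl
    rw [e]
    exact S.exists_norm_nil_of_isEichlerOrder hO'
  have hZ : 0 < Nat.card {g : T → Multiplicative (ZMod 2) // ∃ x ∈ O' * S.twoSidedIdealProd O' (suppSort T g),
      reducedNorm ℚ S.D x = (((suppSort T g).map (localNorm Nplus Nminus)).prod : ℕ)} :=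
    Nat.card_pos_iff.mpr ⟨⟨⟨1, h1⟩⟩, inferInstance⟩
  rw [(eq_iff_of_mul_eq₆₀ key (S.natCard_sameType_pos hO') hZ).1,
    natCard_subtype_eq_one_iff₆₀ (P := fun g : T → Multiplicative (ZMod 2) => ∃ x ∈ O' * S.twoSidedIdealProd O' (suppSort T g),
      reducedNorm ℚ S.D x = (((suppSort T g).map (localNorm Nplus Nminus)).prod : ℕ)) h1]
  exact ⟨fun h g hg hx => hg (h g hx), fun h g hx => by_contra fun hg => h g hg hx⟩

/-- **`#{c : O_L(I_c) ≃ O'} = 1` iff EVERY admissible product of `O'` is principal** (`[N(O') : ℚ^×O'^×] = 2^{ω(N⁺N⁻)}`).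
[cite: Voight2021, Prop. 18.5.10, (18.5.8) and Prop. 18.5.3] -/
theorem XiSetup.natCard_sameType_eq_one_iff {O' : Submodule ℤ S.D} (hO' : Brandt.IsEichlerOrder S.D O' Nplus)
    (hT : (Nplus * Nminus).primeFactors ⊆ T) (hTp : ∀ r ∈ T, r.Prime) :
    Nat.card {c : ClassSet S.O // SameType (leftOrder c.rep) O'} = 1 ↔
      ∀ g : T → Multiplicative (ZMod 2),
        ∃ x ∈ O' * S.twoSidedIdealProd O' (suppSort T g),
          reducedNorm ℚ S.D x = (((suppSort T g).map (localNorm Nplus Nminus)).prod : ℕ) := by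
  have key := S.natCard_sameType_mul_natCard_norm_eq_two_pow T hO' hT hTp
  have hZ : 0 < Nat.card {g : T → Multiplicative (ZMod 2) // ∃ x ∈ O' * S.twoSidedIdealProd O' (suppSort T g),
      reducedNorm ℚ S.D x = (((suppSort T g).map (localNorm Nplus Nminus)).prod : ℕ)} := by
    refine Nat.pos_of_ne_zero fun h0 => ?_
    rw [h0, mul_zero] at key
    exact absurd key (pow_pos two_pos _).ne
  have hG : Nat.card (T → Multiplicative (ZMod 2)) = 2 ^ T.card := by
    rw [Nat.card_eq_fintype_card, Fintype.card_fun, Fintype.card_multiplicative, ZMod.card, Fintype.card_coe]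
  rw [(eq_iff_of_mul_eq₆₀ key (S.natCard_sameType_pos hO') hZ).2, ← hG]
  exact natCard_subtype_eq_card_iff₆₀ _

end Brandt

end Literature.NumberTheory.Automorphic
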